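import Summits.QuantumFields.BalabanUV.Beta.GAN24.AliasObjects
import Summits.QuantumFields.BalabanUV.Beta.GAN24.FibreStepResidues

/-!
# `BalabanUV.Beta.GAN24.ClosedFormBoundOfParts` — binder row G-an2-4 / (CONV-C), road P1-fibre, typer row **P1-Y09d** (node N14d of
# `GAN24/Formal/DAG.md` v2.2): row L09's BOOKKEEPING HALF AS A FUNCTION — the closed-form fibre function is bounded by its parts

NOT IN PRINT; OUR PROOF ATTEMPT.  HONEST FRAMING (cell contract, verbatim): «discharging `BetaPertH` makes Bałaban's UV stability
UNCONDITIONAL — a real constructive-QFT result; it is NOT the continuum limit and NOT the Clay problem.»  HONEST DEPENDENCY (verbatim):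
«continuum YM on T⁴ ⇐ BetaPertH ∧ nine spine estimates (0/9 proved); BetaPertH ⇐ (D1) ∧ (D4) ∧ CAP+tail; G-an2-4 gates asym, D1 and
NE2/3/4.»  [folklore] finite-sum norm algebra (triangle inequality, `‖zw‖ = ‖z‖‖w‖`, unimodular Bloch phases at real momentum) over the
DEFINITIONS of typer row T00 `GAN24/AliasObjects` (p201364) — `kFibClosedW`, `kFibClosed`, `readW`, `Ahat`, `phiSol`, `fhatF`, `eVec`,
`reg`, all BY NAME, nothing redefined; NO estimate of any alias sum, NO cited fact, NO `def … : Prop` hypothesis, NO wall binder.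
NOT summit progress; nothing of (CONV-C)'s K-slot is discharged here.

## What is proved (row text of `HOME/GAN24/Formal/LEAVES.md` v2.2, P1-Y09d, transcribed; where it differs from T00's definitions, T00 wins)
By leg type of `kFibClosedW N M s_f s_m a x′ b y′ p` (T00 §6):
* §2 LEG INEQUALITIES, every complex `p` (the Bloch phase kept as the factor `‖cphase … p‖`):
  `‖ff‖ ≤ s_f² · Σ_m ‖readW m κ x′‖·‖Â_κ(m)[force (l,y′)]‖`,  `‖fm‖ ≤ |s_f||s_m|·‖cphase‖·Σ_m ‖readW m κ x′‖·‖Â_κ(m)[constraint e_l]‖`,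
  `‖mf‖ = |s_m||s_f|·‖cphase‖·‖φ_κ[force (l,y′)]‖`,  `‖mm‖ = s_m²·‖cphase‖·‖φ_κ[constraint e_l]‖`
  (the multiplier legs read `phiSol` ONLY — per T00 the block gauge constant `cSol` enters the legs solely through the pure-gauge part of
  `Ahat`, i.e. inside the `Â`-hypotheses; the row's «or |cSol|» is therefore not a separate hypothesis);
* §3 REAL ZONE `p = ofRealVec q`: `‖cphase v (ofRealVec q)‖ = 1` (`FibreStepResidues.norm_cphase_ofRealVec` BY NAME) is discharged;
* §4 PLUG FORM per leg: from `(hA : ∀ m, ‖Â_κ(m)‖ ≤ α m)` (row Y09a supplies `α`) and `(hW : Σ_m ‖readW m κ x′‖·α m ≤ R)` (row Y09b),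
  `‖ff‖ ≤ s_f²·R`, `‖fm‖ ≤ |s_f||s_m|·R`; from `(hφ : ‖φ_κ‖ ≤ B)` (p1 row L08 = N13), `‖mf‖ ≤ |s_m||s_f|·B`, `‖mm‖ ≤ s_m²·B`;
  the `∀ m ∈ reg`-form of `hA` suffices (`Ahat` VANISHES off the regular set under Lean's `x/0 = 0`, `Ahat_eq_zero_of_not_mem_reg`);
* §5 UNIFORM PLUG FORM over all four leg types: `‖kFibClosedW … a x′ b y′ (ofRealVec q)‖ ≤ s_f²·R_ff + |s_f||s_m|·(R_fm + B_mf) + s_m²·B_mm`;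
* §6 the same for `kFibClosed Lc s_f s_m j = kFibClosedW (Lc^(j+1)) (Lc^j) (s_f j) (s_m j)` (`rfl`).
The unit factors `s_f, s_m` stay OPAQUE real parameters (TRIGGER-P1 c1/c3: row L09 instantiates `sfStep Lc j`, `smStep 3 Lc j`; nothing
of `Lc^j` is plugged here).  Consumers: p1 row L09 `FibreUniformBound` (plugs N13 + Y09a + Y09b, transfers to `kFib` by L05b, `p = 0` by Y09c).
-/

noncomputable section

open Complex Finset
open scoped BigOperators
open Literature.Probability.LatticeModels (TorusSite)
open Literature.MathematicalPhysics.QuantumFieldTheory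
open Literature.MathematicalPhysics.QuantumFieldTheory.LatticeForm (quo)
open Literature.MathematicalPhysics.QuantumFieldTheory.Balaban1983to89
open Literature.MathematicalPhysics.QuantumFieldTheory.Balaban1983to89.Beta
open B4Strip (ofRealVec)
open FibreInverseDecay (cphase)
open OneStepResolventKernel (Fib)
open Summit.QuantumFields.BalabanUV.Beta.GAN24.AliasObjects
  (kFibClosedW kFibClosed readW Ahat phiSol fhatF eVec reg LAl dAl dbAl gAl chiAl cSol mem_reg)
open Summit.QuantumFields.BalabanUV.Beta.GAN24.FibreStepResidues (norm_cphase_ofRealVec)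

namespace Summit.QuantumFields.BalabanUV.Beta.GAN24.ClosedFormBoundOfParts

variable {d : ℕ}

/-! ## §1 Finite-sum helpers and the unit prefactors -/

/-- [folklore] `‖Σ_i f_i g_i‖ ≤ Σ_i ‖f_i‖·‖g_i‖`. -/
theorem norm_sum_mul_le {ι : Type*} (s : Finset ι) (f g : ι → ℂ) :
    ‖∑ i ∈ s, f i * g i‖ ≤ ∑ i ∈ s, ‖f i‖ * ‖g i‖ :=
  (norm_sum_le _ _).trans (le_of_eq (Finset.sum_congr rfl fun _ _ => norm_mul _ _))

/-- [folklore] Monotonicity of a weighted sum in its (bounded) second factor: `‖g_i‖ ≤ α_i ⇒ Σ ‖f_i‖‖g_i‖ ≤ Σ ‖f_i‖ α_i`. -/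
theorem sum_norm_mul_le_of_le {ι : Type*} (s : Finset ι) (f g : ι → ℂ) (α : ι → ℝ) (hg : ∀ i ∈ s, ‖g i‖ ≤ α i) :
    ∑ i ∈ s, ‖f i‖ * ‖g i‖ ≤ ∑ i ∈ s, ‖f i‖ * α i :=
  Finset.sum_le_sum fun i hi => mul_le_mul_of_nonneg_left (hg i hi) (norm_nonneg _)

/-- [folklore] `‖(s_f s_f : ℂ)‖ = s_f²`. -/
theorem norm_ofReal_mul_self (sf : ℝ) : ‖((sf * sf : ℝ) : ℂ)‖ = sf ^ 2 := by
  rw [Complex.norm_real, Real.norm_eq_abs, abs_mul_self, sq]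

/-- [folklore] `‖(s_f s_m : ℂ)‖ = |s_f|·|s_m|`. -/
theorem norm_ofReal_mul (sf sm : ℝ) : ‖((sf * sm : ℝ) : ℂ)‖ = |sf| * |sm| := by
  rw [Complex.norm_real, Real.norm_eq_abs, abs_mul]

/-! ## §2 Leg inequalities at every complex momentum -/

section Legs

variable (N : ℕ) [NeZero N] (M : ℕ) (sf sm : ℝ)

/-- [folklore] Unfolding of the field–field leg. -/
theorem kFibClosedW_ff (κ l : Fin (d + 1)) (x' y' : Fin (d + 1) → ℤ) (p : Fin (d + 1) → ℂ) :
    kFibClosedW N M sf sm (Sum.inl κ) x' (Sum.inl l) y' p =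
      ((sf * sf : ℝ) : ℂ) * ∑ m, readW N M p m κ x' * Ahat N p (fhatF N M p l y') 0 m κ := rfl

/-- [folklore] Unfolding of the field–multiplier leg. -/
theorem kFibClosedW_fm (κ l : Fin (d + 1)) (x' y' : Fin (d + 1) → ℤ) (p : Fin (d + 1) → ℂ) :
    kFibClosedW N M sf sm (Sum.inl κ) x' (Sum.inr l) y' p =
      ((sf * sm : ℝ) : ℂ) * cphase (-quo N ((M : ℤ) • y')) p * ∑ m, readW N M p m κ x' * Ahat N p 0 (eVec l) m κ := rfl

/-- [folklore] Unfolding of the multiplier–field leg. -/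
theorem kFibClosedW_mf (κ l : Fin (d + 1)) (x' y' : Fin (d + 1) → ℤ) (p : Fin (d + 1) → ℂ) :
    kFibClosedW N M sf sm (Sum.inr κ) x' (Sum.inl l) y' p =
      ((sm * sf : ℝ) : ℂ) * cphase (quo N ((M : ℤ) • x')) p * phiSol N p (fhatF N M p l y') 0 κ := rfl

/-- [folklore] Unfolding of the multiplier–multiplier leg. -/
theorem kFibClosedW_mm (κ l : Fin (d + 1)) (x' y' : Fin (d + 1) → ℤ) (p : Fin (d + 1) → ℂ) :
    kFibClosedW N M sf sm (Sum.inr κ) x' (Sum.inr l) y' p =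
      ((sm * sm : ℝ) : ℂ) * cphase (quo N ((M : ℤ) • x') - quo N ((M : ℤ) • y')) p * phiSol N p 0 (eVec l) κ := rfl

/-- [folklore] **FIELD–FIELD LEG INEQUALITY**: `‖ff‖ ≤ s_f² · Σ_m ‖readW(m,κ,x′)‖·‖Â_κ(m)[force (l,y′)]‖`, every complex `p`. -/
theorem norm_ff_le (κ l : Fin (d + 1)) (x' y' : Fin (d + 1) → ℤ) (p : Fin (d + 1) → ℂ) :
    ‖kFibClosedW N M sf sm (Sum.inl κ) x' (Sum.inl l) y' p‖ ≤
      sf ^ 2 * ∑ m, ‖readW N M p m κ x'‖ * ‖Ahat N p (fhatF N M p l y') 0 m κ‖ := by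
  rw [kFibClosedW_ff, norm_mul, norm_ofReal_mul_self]
  exact mul_le_mul_of_nonneg_left (norm_sum_mul_le _ _ _) (sq_nonneg _)

/-- [folklore] **FIELD–MULTIPLIER LEG INEQUALITY**: `‖fm‖ ≤ |s_f||s_m|·‖e^{−ip·quo(M y′)}‖·Σ_m ‖readW(m,κ,x′)‖·‖Â_κ(m)[constraint e_l]‖`. -/
theorem norm_fm_le (κ l : Fin (d + 1)) (x' y' : Fin (d + 1) → ℤ) (p : Fin (d + 1) → ℂ) :
    ‖kFibClosedW N M sf sm (Sum.inl κ) x' (Sum.inr l) y' p‖ ≤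
      |sf| * |sm| * ‖cphase (-quo N ((M : ℤ) • y')) p‖ * ∑ m, ‖readW N M p m κ x'‖ * ‖Ahat N p 0 (eVec l) m κ‖ := by
  rw [kFibClosedW_fm, norm_mul, norm_mul, norm_ofReal_mul]
  exact mul_le_mul_of_nonneg_left (norm_sum_mul_le _ _ _) (by positivity)

/-- [folklore] **MULTIPLIER–FIELD LEG IDENTITY**: `‖mf‖ = |s_m||s_f|·‖e^{ip·quo(M x′)}‖·‖φ_κ[force (l,y′)]‖`. -/
theorem norm_mf_eq (κ l : Fin (d + 1)) (x' y' : Fin (d + 1) → ℤ) (p : Fin (d + 1) → ℂ) :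
    ‖kFibClosedW N M sf sm (Sum.inr κ) x' (Sum.inl l) y' p‖ =
      |sm| * |sf| * ‖cphase (quo N ((M : ℤ) • x')) p‖ * ‖phiSol N p (fhatF N M p l y') 0 κ‖ := by
  rw [kFibClosedW_mf, norm_mul, norm_mul, norm_ofReal_mul]

/-- [folklore] **MULTIPLIER–MULTIPLIER LEG IDENTITY**: `‖mm‖ = s_m²·‖e^{ip·(quo(M x′) − quo(M y′))}‖·‖φ_κ[constraint e_l]‖`. -/
theorem norm_mm_eq (κ l : Fin (d + 1)) (x' y' : Fin (d + 1) → ℤ) (p : Fin (d + 1) → ℂ) :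
    ‖kFibClosedW N M sf sm (Sum.inr κ) x' (Sum.inr l) y' p‖ =
      sm ^ 2 * ‖cphase (quo N ((M : ℤ) • x') - quo N ((M : ℤ) • y')) p‖ * ‖phiSol N p 0 (eVec l) κ‖ := by
  rw [kFibClosedW_mm, norm_mul, norm_mul, norm_ofReal_mul_self]

/-! ## §3 Real zone: the Bloch phases are unimodular -/

/-- [folklore] `‖fm‖ ≤ |s_f||s_m|·Σ_m ‖readW‖·‖Â‖` at real momentum. -/
theorem norm_fm_le_real (κ l : Fin (d + 1)) (x' y' : Fin (d + 1) → ℤ) (q : Fin (d + 1) → ℝ) :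
    ‖kFibClosedW N M sf sm (Sum.inl κ) x' (Sum.inr l) y' (ofRealVec q)‖ ≤
      |sf| * |sm| * ∑ m, ‖readW N M (ofRealVec q) m κ x'‖ * ‖Ahat N (ofRealVec q) 0 (eVec l) m κ‖ := by
  have h := norm_fm_le N M sf sm κ l x' y' (ofRealVec q)
  rwa [norm_cphase_ofRealVec, mul_one] at h

/-- [folklore] `‖mf‖ = |s_m||s_f|·‖φ_κ[force]‖` at real momentum. -/
theorem norm_mf_eq_real (κ l : Fin (d + 1)) (x' y' : Fin (d + 1) → ℤ) (q : Fin (d + 1) → ℝ) :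
    ‖kFibClosedW N M sf sm (Sum.inr κ) x' (Sum.inl l) y' (ofRealVec q)‖ =
      |sm| * |sf| * ‖phiSol N (ofRealVec q) (fhatF N M (ofRealVec q) l y') 0 κ‖ := by
  rw [norm_mf_eq, norm_cphase_ofRealVec, mul_one]

/-- [folklore] `‖mm‖ = s_m²·‖φ_κ[constraint e_l]‖` at real momentum. -/
theorem norm_mm_eq_real (κ l : Fin (d + 1)) (x' y' : Fin (d + 1) → ℤ) (q : Fin (d + 1) → ℝ) :
    ‖kFibClosedW N M sf sm (Sum.inr κ) x' (Sum.inr l) y' (ofRealVec q)‖ =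
      sm ^ 2 * ‖phiSol N (ofRealVec q) 0 (eVec l) κ‖ := by
  rw [norm_mm_eq, norm_cphase_ofRealVec, mul_one]

end Legs

/-! ## §4 Plug form per leg: the analytic inputs as hypotheses -/

section Plug

variable (N : ℕ) [NeZero N] (M : ℕ) (sf sm : ℝ)

/-- [folklore] Off the regular set the field amplitude VANISHES (Lean's `x / 0 = 0` inside `FibreBlockSolve.Asol` at `L_m = 0`) — so
`Â`-hypotheses need only be checked on `reg N p`. -/
theorem Ahat_eq_zero_of_not_mem_reg {D : ℕ} (p : Fin D → ℂ) (fhat : TorusSite D N → Fin D → ℂ) (chat : Fin D → ℂ)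
    {m : TorusSite D N} (hm : m ∉ reg N p) : Ahat N p fhat chat m = 0 := by
  have hL : LAl N p m = 0 := by
    by_contra h
    exact hm ((mem_reg N p m).2 h)
  funext κ
  simp [Ahat, FibreBlockSolve.Asol, hL]

/-- [folklore] A bound on the regular set with a nonnegative majorant is a bound everywhere. -/
theorem norm_Ahat_le_of_reg {D : ℕ} (p : Fin D → ℂ) (fhat : TorusSite D N → Fin D → ℂ) (chat : Fin D → ℂ) (κ : Fin D)
    (α : TorusSite D N → ℝ) (hα : ∀ m, 0 ≤ α m) (hA : ∀ m ∈ reg N p, ‖Ahat N p fhat chat m κ‖ ≤ α m) (m : TorusSite D N) :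
    ‖Ahat N p fhat chat m κ‖ ≤ α m := by
  by_cases hm : m ∈ reg N p
  · exact hA m hm
  · rw [Ahat_eq_zero_of_not_mem_reg N p fhat chat hm, Pi.zero_apply, norm_zero]
    exact hα m

/-- [folklore] **ff PLUG FORM**: per-alias response bound `α` (row Y09a) + reading-weight sum `R` (row Y09b) ⇒ `‖ff‖ ≤ s_f²·R`, every complex `p`. -/
theorem norm_ff_le_of_parts (κ l : Fin (d + 1)) (x' y' : Fin (d + 1) → ℤ) (p : Fin (d + 1) → ℂ)
    (α : TorusSite (d + 1) N → ℝ) {R : ℝ} (hA : ∀ m, ‖Ahat N p (fhatF N M p l y') 0 m κ‖ ≤ α m)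
    (hW : ∑ m, ‖readW N M p m κ x'‖ * α m ≤ R) :
    ‖kFibClosedW N M sf sm (Sum.inl κ) x' (Sum.inl l) y' p‖ ≤ sf ^ 2 * R :=
  (norm_ff_le N M sf sm κ l x' y' p).trans
    (mul_le_mul_of_nonneg_left ((sum_norm_mul_le_of_le _ _ _ α fun m _ => hA m).trans hW) (sq_nonneg _))

/-- [folklore] **ff PLUG FORM, regular-set hypotheses** (`α ≥ 0`). -/
theorem norm_ff_le_of_parts_reg (κ l : Fin (d + 1)) (x' y' : Fin (d + 1) → ℤ) (p : Fin (d + 1) → ℂ)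
    (α : TorusSite (d + 1) N → ℝ) {R : ℝ} (hα : ∀ m, 0 ≤ α m)
    (hA : ∀ m ∈ reg N p, ‖Ahat N p (fhatF N M p l y') 0 m κ‖ ≤ α m) (hW : ∑ m, ‖readW N M p m κ x'‖ * α m ≤ R) :
    ‖kFibClosedW N M sf sm (Sum.inl κ) x' (Sum.inl l) y' p‖ ≤ sf ^ 2 * R :=
  norm_ff_le_of_parts N M sf sm κ l x' y' p α (norm_Ahat_le_of_reg N p _ _ κ α hα hA) hW

/-- [folklore] **fm PLUG FORM** (real zone): `‖fm‖ ≤ |s_f||s_m|·R`. -/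
theorem norm_fm_le_of_parts (κ l : Fin (d + 1)) (x' y' : Fin (d + 1) → ℤ) (q : Fin (d + 1) → ℝ)
    (α : TorusSite (d + 1) N → ℝ) {R : ℝ} (hA : ∀ m, ‖Ahat N (ofRealVec q) 0 (eVec l) m κ‖ ≤ α m)
    (hW : ∑ m, ‖readW N M (ofRealVec q) m κ x'‖ * α m ≤ R) :
    ‖kFibClosedW N M sf sm (Sum.inl κ) x' (Sum.inr l) y' (ofRealVec q)‖ ≤ |sf| * |sm| * R :=
  (norm_fm_le_real N M sf sm κ l x' y' q).trans
    (mul_le_mul_of_nonneg_left ((sum_norm_mul_le_of_le _ _ _ α fun m _ => hA m).trans hW) (by positivity))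

/-- [folklore] **fm PLUG FORM, regular-set hypotheses** (`α ≥ 0`, real zone). -/
theorem norm_fm_le_of_parts_reg (κ l : Fin (d + 1)) (x' y' : Fin (d + 1) → ℤ) (q : Fin (d + 1) → ℝ)
    (α : TorusSite (d + 1) N → ℝ) {R : ℝ} (hα : ∀ m, 0 ≤ α m)
    (hA : ∀ m ∈ reg N (ofRealVec q), ‖Ahat N (ofRealVec q) 0 (eVec l) m κ‖ ≤ α m)
    (hW : ∑ m, ‖readW N M (ofRealVec q) m κ x'‖ * α m ≤ R) :
    ‖kFibClosedW N M sf sm (Sum.inl κ) x' (Sum.inr l) y' (ofRealVec q)‖ ≤ |sf| * |sm| * R :=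
  norm_fm_le_of_parts N M sf sm κ l x' y' q α (norm_Ahat_le_of_reg N _ _ _ κ α hα hA) hW

/-- [folklore] **mf PLUG FORM** (real zone): `‖φ_κ[force (l,y′)]‖ ≤ B ⇒ ‖mf‖ ≤ |s_m||s_f|·B`. -/
theorem norm_mf_le_of_parts (κ l : Fin (d + 1)) (x' y' : Fin (d + 1) → ℤ) (q : Fin (d + 1) → ℝ) {B : ℝ}
    (hφ : ‖phiSol N (ofRealVec q) (fhatF N M (ofRealVec q) l y') 0 κ‖ ≤ B) :
    ‖kFibClosedW N M sf sm (Sum.inr κ) x' (Sum.inl l) y' (ofRealVec q)‖ ≤ |sm| * |sf| * B := by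
  rw [norm_mf_eq_real]
  exact mul_le_mul_of_nonneg_left hφ (by positivity)

/-- [folklore] **mm PLUG FORM** (real zone): `‖φ_κ[constraint e_l]‖ ≤ B ⇒ ‖mm‖ ≤ s_m²·B`. -/
theorem norm_mm_le_of_parts (κ l : Fin (d + 1)) (x' y' : Fin (d + 1) → ℤ) (q : Fin (d + 1) → ℝ) {B : ℝ}
    (hφ : ‖phiSol N (ofRealVec q) 0 (eVec l) κ‖ ≤ B) :
    ‖kFibClosedW N M sf sm (Sum.inr κ) x' (Sum.inr l) y' (ofRealVec q)‖ ≤ sm ^ 2 * B := by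
  rw [norm_mm_eq_real]
  exact mul_le_mul_of_nonneg_left hφ (sq_nonneg _)

end Plug

/-! ## §5 Uniform plug form over the four leg types -/

section Uniform

variable (N : ℕ) [NeZero N] (M : ℕ) (sf sm : ℝ)

/-- [folklore] **UNIFORM PLUG FORM** at real momentum `q`: if every ff reading sum is `≤ R_ff`, every fm reading sum `≤ R_fm`, every multiplier
response to a force `≤ B_mf` and to a constraint `≤ B_mm` (all four nonnegative), then for EVERY leg pair
`‖kFibClosedW N M s_f s_m a x′ b y′ (ofRealVec q)‖ ≤ s_f²·R_ff + |s_f||s_m|·(R_fm + B_mf) + s_m²·B_mm`. -/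
theorem norm_kFibClosedW_le_of_parts (q : Fin (d + 1) → ℝ) {Rff Rfm Bmf Bmm : ℝ}
    (hRff : 0 ≤ Rff) (hRfm : 0 ≤ Rfm) (hBmf : 0 ≤ Bmf) (hBmm : 0 ≤ Bmm)
    (hff : ∀ κ l x' y', ∑ m, ‖readW N M (ofRealVec q) m κ x'‖ * ‖Ahat N (ofRealVec q) (fhatF N M (ofRealVec q) l y') 0 m κ‖ ≤ Rff)
    (hfm : ∀ κ l x', ∑ m, ‖readW N M (ofRealVec q) m κ x'‖ * ‖Ahat N (ofRealVec q) 0 (eVec l) m κ‖ ≤ Rfm)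
    (hmf : ∀ κ l y', ‖phiSol N (ofRealVec q) (fhatF N M (ofRealVec q) l y') 0 κ‖ ≤ Bmf)
    (hmm : ∀ κ l, ‖phiSol N (ofRealVec q) 0 (eVec l) κ‖ ≤ Bmm)
    (a : Fib d) (x' : Fin (d + 1) → ℤ) (b : Fib d) (y' : Fin (d + 1) → ℤ) :
    ‖kFibClosedW N M sf sm a x' b y' (ofRealVec q)‖ ≤ sf ^ 2 * Rff + |sf| * |sm| * (Rfm + Bmf) + sm ^ 2 * Bmm := by
  have h1 : 0 ≤ sf ^ 2 * Rff := mul_nonneg (sq_nonneg _) hRff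
  have h2 : 0 ≤ |sf| * |sm| * Rfm := by positivity
  have h3 : 0 ≤ |sf| * |sm| * Bmf := by positivity
  have h4 : 0 ≤ sm ^ 2 * Bmm := mul_nonneg (sq_nonneg _) hBmm
  rcases a with κ | κ <;> rcases b with l | l
  · have h := (norm_ff_le N M sf sm κ l x' y' (ofRealVec q)).trans (mul_le_mul_of_nonneg_left (hff κ l x' y') (sq_nonneg _))
    nlinarith
  · have h := (norm_fm_le_real N M sf sm κ l x' y' q).trans (mul_le_mul_of_nonneg_left (hfm κ l x') (by positivity))
    nlinarith
  · have h := norm_mf_le_of_parts N M sf sm κ l x' y' q (hmf κ l y')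
    have e : |sm| * |sf| * Bmf = |sf| * |sm| * Bmf := by ring
    rw [e] at h
    nlinarith
  · have h := norm_mm_le_of_parts N M sf sm κ l x' y' q (hmm κ l)
    nlinarith

/-- [folklore] The same with nonnegative units `0 ≤ s_f`, `0 ≤ s_m` (as for `sfStep`, `smStep`): `s_f²·R_ff + s_f s_m·(R_fm + B_mf) + s_m²·B_mm`. -/
theorem norm_kFibClosedW_le_of_parts' (hsf : 0 ≤ sf) (hsm : 0 ≤ sm) (q : Fin (d + 1) → ℝ) {Rff Rfm Bmf Bmm : ℝ}
    (hRff : 0 ≤ Rff) (hRfm : 0 ≤ Rfm) (hBmf : 0 ≤ Bmf) (hBmm : 0 ≤ Bmm)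
    (hff : ∀ κ l x' y', ∑ m, ‖readW N M (ofRealVec q) m κ x'‖ * ‖Ahat N (ofRealVec q) (fhatF N M (ofRealVec q) l y') 0 m κ‖ ≤ Rff)
    (hfm : ∀ κ l x', ∑ m, ‖readW N M (ofRealVec q) m κ x'‖ * ‖Ahat N (ofRealVec q) 0 (eVec l) m κ‖ ≤ Rfm)
    (hmf : ∀ κ l y', ‖phiSol N (ofRealVec q) (fhatF N M (ofRealVec q) l y') 0 κ‖ ≤ Bmf)
    (hmm : ∀ κ l, ‖phiSol N (ofRealVec q) 0 (eVec l) κ‖ ≤ Bmm)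
    (a : Fib d) (x' : Fin (d + 1) → ℤ) (b : Fib d) (y' : Fin (d + 1) → ℤ) :
    ‖kFibClosedW N M sf sm a x' b y' (ofRealVec q)‖ ≤ sf ^ 2 * Rff + sf * sm * (Rfm + Bmf) + sm ^ 2 * Bmm := by
  have h := norm_kFibClosedW_le_of_parts N M sf sm q hRff hRfm hBmf hBmm hff hfm hmf hmm a x' b y'
  rwa [abs_of_nonneg hsf, abs_of_nonneg hsm] at h

/-- [folklore] **UNIFORM PLUG FORM FROM PER-ALIAS DATA**: response majorants `α_F l y′ m`, `α_C l m ≥ 0` on the regular set (row Y09a),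
reading-weight sums against them `≤ R_ff`, `≤ R_fm` (row Y09b), multiplier bounds `B_mf`, `B_mm` (row L08/N13) ⇒ the bound of
`norm_kFibClosedW_le_of_parts`. -/
theorem norm_kFibClosedW_le_of_alias_parts (q : Fin (d + 1) → ℝ) {Rff Rfm Bmf Bmm : ℝ}
    (hRff : 0 ≤ Rff) (hRfm : 0 ≤ Rfm) (hBmf : 0 ≤ Bmf) (hBmm : 0 ≤ Bmm)
    (αF : Fin (d + 1) → (Fin (d + 1) → ℤ) → TorusSite (d + 1) N → ℝ) (αC : Fin (d + 1) → TorusSite (d + 1) N → ℝ)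
    (hαF : ∀ l y' m, 0 ≤ αF l y' m) (hαC : ∀ l m, 0 ≤ αC l m)
    (hAF : ∀ κ l y', ∀ m ∈ reg N (ofRealVec q), ‖Ahat N (ofRealVec q) (fhatF N M (ofRealVec q) l y') 0 m κ‖ ≤ αF l y' m)
    (hAC : ∀ κ l, ∀ m ∈ reg N (ofRealVec q), ‖Ahat N (ofRealVec q) 0 (eVec l) m κ‖ ≤ αC l m)
    (hWF : ∀ κ l x' y', ∑ m, ‖readW N M (ofRealVec q) m κ x'‖ * αF l y' m ≤ Rff)
    (hWC : ∀ κ l x', ∑ m, ‖readW N M (ofRealVec q) m κ x'‖ * αC l m ≤ Rfm)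
    (hmf : ∀ κ l y', ‖phiSol N (ofRealVec q) (fhatF N M (ofRealVec q) l y') 0 κ‖ ≤ Bmf)
    (hmm : ∀ κ l, ‖phiSol N (ofRealVec q) 0 (eVec l) κ‖ ≤ Bmm)
    (a : Fib d) (x' : Fin (d + 1) → ℤ) (b : Fib d) (y' : Fin (d + 1) → ℤ) :
    ‖kFibClosedW N M sf sm a x' b y' (ofRealVec q)‖ ≤ sf ^ 2 * Rff + |sf| * |sm| * (Rfm + Bmf) + sm ^ 2 * Bmm := by
  refine norm_kFibClosedW_le_of_parts N M sf sm q hRff hRfm hBmf hBmm (fun κ l x' y' => ?_) (fun κ l x' => ?_) hmf hmm a x' b y'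
  · exact (sum_norm_mul_le_of_le _ _ _ (αF l y')
      fun m _ => norm_Ahat_le_of_reg N _ _ _ κ (αF l y') (hαF l y') (hAF κ l y') m).trans (hWF κ l x' y')
  · exact (sum_norm_mul_le_of_le _ _ _ (αC l)
      fun m _ => norm_Ahat_le_of_reg N _ _ _ κ (αC l) (hαC l) (hAC κ l) m).trans (hWC κ l x')

end Uniform

/-! ## §6 The step function `kFibClosed Lc s_f s_m j` -/

section Step

variable (Lc : ℕ) [NeZero Lc] (sf sm : ℕ → ℝ) (j : ℕ)

/-- [folklore] `kFibClosed Lc s_f s_m j = kFibClosedW (Lc^(j+1)) (Lc^j) (s_f j) (s_m j)` (T00's definition, `rfl`). -/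
theorem kFibClosed_eq (a : Fib d) (x' : Fin (d + 1) → ℤ) (b : Fib d) (y' : Fin (d + 1) → ℤ) :
    kFibClosed Lc sf sm j a x' b y' = kFibClosedW (Lc ^ (j + 1)) (Lc ^ j) (sf j) (sm j) a x' b y' := rfl

/-- [folklore] **UNIFORM PLUG FORM FOR THE STEP FUNCTION** at level `j` (`N = Lc^(j+1)`, `M = Lc^j`), units `s_f j`, `s_m j` OPAQUE. -/
theorem norm_kFibClosed_le_of_parts (q : Fin (d + 1) → ℝ) {Rff Rfm Bmf Bmm : ℝ}
    (hRff : 0 ≤ Rff) (hRfm : 0 ≤ Rfm) (hBmf : 0 ≤ Bmf) (hBmm : 0 ≤ Bmm)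
    (hff : ∀ κ l x' y', ∑ m, ‖readW (Lc ^ (j + 1)) (Lc ^ j) (ofRealVec q) m κ x'‖ *
      ‖Ahat (Lc ^ (j + 1)) (ofRealVec q) (fhatF (Lc ^ (j + 1)) (Lc ^ j) (ofRealVec q) l y') 0 m κ‖ ≤ Rff)
    (hfm : ∀ κ l x', ∑ m, ‖readW (Lc ^ (j + 1)) (Lc ^ j) (ofRealVec q) m κ x'‖ *
      ‖Ahat (Lc ^ (j + 1)) (ofRealVec q) 0 (eVec l) m κ‖ ≤ Rfm)
    (hmf : ∀ κ l y', ‖phiSol (Lc ^ (j + 1)) (ofRealVec q) (fhatF (Lc ^ (j + 1)) (Lc ^ j) (ofRealVec q) l y') 0 κ‖ ≤ Bmf)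
    (hmm : ∀ κ l, ‖phiSol (Lc ^ (j + 1)) (ofRealVec q) 0 (eVec l) κ‖ ≤ Bmm)
    (a : Fib d) (x' : Fin (d + 1) → ℤ) (b : Fib d) (y' : Fin (d + 1) → ℤ) :
    ‖kFibClosed Lc sf sm j a x' b y' (ofRealVec q)‖ ≤
      sf j ^ 2 * Rff + |sf j| * |sm j| * (Rfm + Bmf) + sm j ^ 2 * Bmm := by
  rw [kFibClosed_eq]
  exact norm_kFibClosedW_le_of_parts _ _ _ _ q hRff hRfm hBmf hBmm hff hfm hmf hmm a x' b y'

/-- [folklore] The step version with nonnegative unit sequences (`sfStep`, `smStep` are powers of `Lc`). -/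
theorem norm_kFibClosed_le_of_parts' (hsf : 0 ≤ sf j) (hsm : 0 ≤ sm j) (q : Fin (d + 1) → ℝ) {Rff Rfm Bmf Bmm : ℝ}
    (hRff : 0 ≤ Rff) (hRfm : 0 ≤ Rfm) (hBmf : 0 ≤ Bmf) (hBmm : 0 ≤ Bmm)
    (hff : ∀ κ l x' y', ∑ m, ‖readW (Lc ^ (j + 1)) (Lc ^ j) (ofRealVec q) m κ x'‖ *
      ‖Ahat (Lc ^ (j + 1)) (ofRealVec q) (fhatF (Lc ^ (j + 1)) (Lc ^ j) (ofRealVec q) l y') 0 m κ‖ ≤ Rff)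
    (hfm : ∀ κ l x', ∑ m, ‖readW (Lc ^ (j + 1)) (Lc ^ j) (ofRealVec q) m κ x'‖ *
      ‖Ahat (Lc ^ (j + 1)) (ofRealVec q) 0 (eVec l) m κ‖ ≤ Rfm)
    (hmf : ∀ κ l y', ‖phiSol (Lc ^ (j + 1)) (ofRealVec q) (fhatF (Lc ^ (j + 1)) (Lc ^ j) (ofRealVec q) l y') 0 κ‖ ≤ Bmf)
    (hmm : ∀ κ l, ‖phiSol (Lc ^ (j + 1)) (ofRealVec q) 0 (eVec l) κ‖ ≤ Bmm)
    (a : Fib d) (x' : Fin (d + 1) → ℤ) (b : Fib d) (y' : Fin (d + 1) → ℤ) :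
    ‖kFibClosed Lc sf sm j a x' b y' (ofRealVec q)‖ ≤ sf j ^ 2 * Rff + sf j * sm j * (Rfm + Bmf) + sm j ^ 2 * Bmm := by
  rw [kFibClosed_eq]
  exact norm_kFibClosedW_le_of_parts' _ _ _ _ hsf hsm q hRff hRfm hBmf hBmm hff hfm hmf hmm a x' b y'

end Step

end Summit.QuantumFields.BalabanUV.Beta.GAN24.ClosedFormBoundOfParts

end
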